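import Literature.LinearAlgebra.Matrix.GL2ZSL2ZClassSplitting
import Mathlib.Data.Int.Interval
import HarnessLib

/-!
# Hertling–Larabi 2026b THEOREM 7.10 (b) made effective: the finite set `M(r, s)` of (semi-)normal forms as an
# explicit FINSET of pairs `(a, c)` — so that the number of `SL₂(ℤ)`- and `GL₂(ℤ)`-conjugacy classes of integer
# `2 × 2` matrices with characteristic polynomial `t² − rt + s`, `r² − 4s < 0`, is COMPUTED by `decide` — and
# EXAMPLES 7.11 (i), (ii): `|M(0, 5)| = 4`, `|M(0, 20)| = 12` («12 `SL_2(ℤ)` conjugacy classes and 6 `GL_2(ℤ)`-conjugacy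
# classes of matrices with characteristic polynomial `t² + 20`»)

[topic LinearAlgebra/Matrix] Sequel to `SL2ZIrreducibleNormalForms` (Thm. 7.10: `M(r, s)`, representatives, unique
normal forms for `D < 0`; `natCard_quot_sl2_conj_eq`) and `GL2ZSL2ZClassSplitting` (Thm. 7.9 (b):
`#SL₂-classes = 2·#GL₂-classes`).  Lane `lit-hodgefound` (Track 2 foundations library), seat p19 generation 39, row
g39-#5.  THEOREMS ONLY: no definition, no instance, no notation, no named fact (D-0026, net Literature debt `0`),
no `sorry`.

The point.  A matrix `(a b; c d) ∈ M(r, s)` is determined by `(a, c)`: `d = r − a` and `b = (a(r − a) − s)/c`; and the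
proof of Theorem 7.10 (b) bounds `a` and `c` («`|c| ≤ √((4/3)|D|)`», «`|a − r/2| ≤ |c|/2`»).  So `M(r, s)` is in
bijection with the finset written out here as
`T(r, s) = {(a, c) ∈ [−(⌊|4D|/3⌋ + |r|), ⌊|4D|/3⌋ + |r|] × [−⌊|4D|/3⌋, ⌊|4D|/3⌋] | c ≠ 0, c ∣ a(r−a) − s,
|c| ≤ |b|, 2a − r ∈ (−|c|, |c|], (|c| = |b| → 2a − r ≥ 0)}` with `b = (a(r−a) − s)/c`, `4D = r² − 4s`
(`Finset.filter` of a product of `Finset.Icc`s — decidable, so `decide` evaluates its cardinality), and for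
`r² − 4s < 0` the class numbers of Theorem 7.10 (c)(iii) / Theorem 7.9 (b) are `|T(r, s)|` and `|T(r, s)|/2`.

## Source, VERBATIM

C. Hertling, K. Larabi, *Conjugacy classes of regular integer matrices*, arXiv:2602.15748 (2026)
[HertlingLarabi2026b], held `paper:arxiv-2602.15748`, §7.3, chunks p0017–p0019:
«**Theorem 7.10.** […] (b) The set `M(r, s) := {(a b; c d) ∈ M_{2×2}(ℤ) | a + d = r, ad − bc = s, 0 < |c| ≤ |b|,
a − d ∈ (−|c|, |c|], in the case |c| = |b| a − d ∈ [0, |c|]}` is finite and not empty. […] Proof: (b) The case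
`D < 0`: […] `c² ≤ (4/3)|D|`, so `|c| ≤ √((4/3)|D|)`, `|a − r/2| = |d − r/2| = |(a−d)/2| ≤ |c|/2 ≤ √(⅓|D|)`. […]
`|b| ≤ ¼c² − D ≤ (4/3)|D|`. Therefore the set `M(r, s)` is finite. The case `D > 0`: […] `c² ≤ bc ≤ D` […]»
«**Examples 7.11.** (i) […] `M(0, 5) = {(0 −5; 1 0), (0 5; −1 0), (1 −3; 2 −1), (1 3; −2 −1)}`. Therefore there
are four `SL_2(ℤ)`-conjugacy classes and two `GL_2(ℤ)`-conjugacy classes […]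
(ii) Now we are interested in matrices in `M_{2×2}(ℤ)` with characteristic polynomial `p_2(t) = t² + 20`. […] Here
`r = 0`, `s = 20`, `D = r²/4 − s = −20 < 0`. The proof of Theorem 7.10 (b) gives for matrices `(a b; c d) ∈ M(0, 20)`
the (in)equalities `0 < |c| ≤ ⌊√((4/3)|D|)⌋ = 5`, `d = −a`, `2a ∈ (−|c|, |c|]`, so `a ∈ [−2, 2]`, if `|b| = |c|`
then `a ∈ [0, 2]`, `|c| ≤ |b| ≤ ⌊(4/3)|D|⌋ = 26`. The case `a = 2`: `−bc = 24`, `|c| ≥ 2a = 4`, `(2 −6; 4 −2)`,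
`(2 6; −4 −2)`. The case `a = 1`: `−bc = 21`, `|c| ≥ 2a = 2`, `(1 −7; 3 −1)`, `(1 7; −3 −1)`. The case `a = 0`:
`−bc = 20`, `(0 −20; 1 0)`, `(0 20; −1 0)`, `(0 −10; 2 0)`, `(0 10; −2 0)`, `(0 −5; 4 0)`, `(0 5; −4 0)`. The
case `a = −1`: `−bc = 21`, `|c| > 2|a| = 2`, `(−1 −7; 3 1)`, `(−1 7; −3 1)`. The case `a = −2`: `−bc = 24`,
`|c| > 2|a| = 4`, `|c| ≤ |b|`, impossible. `M(0, 20)` contains 12 matrices, so there are 12 `SL_2(ℤ)` conjugacy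
classes and 6 `GL_2(ℤ)`-conjugacy classes of matrices with characteristic polynomial `p_2(t) = t² + 20`, with
representatives those 6 matrices `B = (a b; c d)` of the 12 matrices above which satisfy `c > 0`.»

## What is proved

* §1 `abs_le_and_abs_le` (the bounds `|c| ≤ ⌊|4D|/3⌋`, `|a| ≤ ⌊|4D|/3⌋ + |r|` for `(a b; c d) ∈ M(r, s)`, every
  `r, s`), **`mem_normalForms_iff`** (`B ∈ M(r, s)` iff `(B 0 0, B 1 0) ∈ T(r, s)` and
  `B = (a, (a(r−a)−s)/c; c, r−a)`), **`natCard_normalForms_eq_card`** (`|M(r, s)| = |T(r, s)|`).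
* §2 for `r² − 4s < 0`: **`natCard_quot_sl2_conj_eq_card`** (number of `SL₂(ℤ)`-classes `= |T(r, s)|`) and
  **`natCard_quot_gl2_conj_eq_card_div_two`** (number of `GL₂(ℤ)`-classes `= |T(r, s)|/2`).
* §3 **EXAMPLES 7.11** by `decide`: `card_T_zero_five` (`= 4`), `card_T_zero_twenty` (`= 12`),
  `natCard_quot_sl2_conj_zero_twenty` (`= 12`), `natCard_quot_gl2_conj_zero_twenty` (`= 6`); and, as further checks
  of the machine, `card_T_zero_one` (`t² + 1`: `2` classes, i.e. one `GL₂(ℤ)`-class — `ℤ[i]` is principal) and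
  `card_T_zero_neg_two` (type IV, `t² − 2`: `M(0, −2)` has `2` semi-normal forms).

## References

* [HertlingLarabi2026b] C. Hertling, K. Larabi, arXiv:2602.15748 (2026), §7.3 Theorem 7.10 (b) with proof and
  Examples 7.11 (i), (ii) (chunks p0017–p0019). [cite: HertlingLarabi2026b, §7.3 Theorem 7.10 (b) and Examples 7.11, chunks p0017–p0019]
-/

namespace Literature.LinearAlgebra.Matrix.SL2ZNormalFormsEnumeration

open Literature.LinearAlgebra.Matrix.SL2ZIrreducibleNormalForms
open Literature.LinearAlgebra.Matrix.GL2ZSL2ZClassSplitting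

/-! ## §1 `M(r, s)` as a finset of pairs `(a, c)` -/

/-- **The bounds of the proof of Theorem 7.10 (b), uniformly in the sign of `D`**: for `(a b; c d) ∈ M(r, s)`,
`3c² ≤ |4D|` (so `|c| ≤ ⌊|4D|/3⌋`) and `|a − d| ≤ |c|` (so `|a| ≤ ⌊|4D|/3⌋ + |r|`), `4D = r² − 4s`, `r = a + d`.
[cite: HertlingLarabi2026b, §7.3 Theorem 7.10 (b) (proof), chunk p0017] -/
theorem abs_le_and_abs_le {a b c d : ℤ} (hc : c ≠ 0) (hcb : |c| ≤ |b|) (h₁ : -|c| < a - d) (h₂ : a - d ≤ |c|) :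
    |c| ≤ |(a + d) ^ 2 - 4 * (a * d - b * c)| / 3 ∧ |a| ≤ |(a + d) ^ 2 - 4 * (a * d - b * c)| / 3 + |a + d| := by
  have h3 : 3 * c ^ 2 ≤ |(a + d) ^ 2 - 4 * (a * d - b * c)| := by
    rcases lt_or_ge ((a + d) ^ 2 - 4 * (a * d - b * c)) 0 with hneg | hnn
    · obtain ⟨-, h, -, -⟩ := bounds_of_discr_neg hc hcb h₁ h₂ hneg
      rwa [abs_of_neg hneg]
    · obtain ⟨-, h, -, -⟩ := bounds_of_discr_nonneg hc hcb h₁ h₂ hnn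
      rw [abs_of_nonneg hnn]
      linarith [sq_nonneg c]
  have hcsq : |c| ≤ c ^ 2 := by
    rw [← sq_abs]
    nlinarith [Int.one_le_abs hc]
  have hcle : |c| ≤ |(a + d) ^ 2 - 4 * (a * d - b * c)| / 3 :=
    Int.le_ediv_of_mul_le (by norm_num) (by linarith)
  refine ⟨hcle, ?_⟩
  have had : |a - d| ≤ |c| := abs_le.2 ⟨h₁.le, h₂⟩
  have h2a : |2 * a| ≤ |a - d| + |a + d| := by
    rw [show 2 * a = (a - d) + (a + d) by ring]
    exact abs_add_le _ _
  rw [abs_mul, abs_two] at h2a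
  linarith [abs_nonneg a]

/-- **`M(r, s)` ↔ the finset `T(r, s)` of pairs `(a, c)`**: `(a b; c d) ∈ M(r, s)` iff `d = r − a`,
`b = (a(r − a) − s)/c` and `(a, c)` satisfies the (decidable) conditions of `T(r, s)`.
[cite: HertlingLarabi2026b, §7.3 Theorem 7.10 (b) (proof) and Examples 7.11 (ii) (the enumeration by `a` and `c`), chunks p0017–p0019] -/
theorem mem_normalForms_iff (r s : ℤ) (B : Matrix (Fin 2) (Fin 2) ℤ) :
    B ∈ {B : Matrix (Fin 2) (Fin 2) ℤ | B.trace = r ∧ B.det = s ∧ B 1 0 ≠ 0 ∧ |B 1 0| ≤ |B 0 1| ∧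
        -|B 1 0| < B 0 0 - B 1 1 ∧ B 0 0 - B 1 1 ≤ |B 1 0| ∧ (|B 1 0| = |B 0 1| → 0 ≤ B 0 0 - B 1 1)} ↔
      (B 0 0, B 1 0) ∈ ((Finset.Icc (-(|r ^ 2 - 4 * s| / 3 + |r|)) (|r ^ 2 - 4 * s| / 3 + |r|)) ×ˢ
          (Finset.Icc (-(|r ^ 2 - 4 * s| / 3)) (|r ^ 2 - 4 * s| / 3))).filter
          (fun p : ℤ × ℤ => p.2 ≠ 0 ∧ p.2 ∣ p.1 * (r - p.1) - s ∧ |p.2| ≤ |(p.1 * (r - p.1) - s) / p.2| ∧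
            -|p.2| < 2 * p.1 - r ∧ 2 * p.1 - r ≤ |p.2| ∧ (|p.2| = |(p.1 * (r - p.1) - s) / p.2| → 0 ≤ 2 * p.1 - r)) ∧
        B = !![B 0 0, (B 0 0 * (r - B 0 0) - s) / B 1 0; B 1 0, r - B 0 0] := by
  simp only [Set.mem_setOf_eq, Finset.mem_filter, Finset.mem_product, Finset.mem_Icc]
  constructor
  · rintro ⟨htr, hdet, hc, hcb, h₁, h₂, h₃⟩
    rw [Matrix.trace_fin_two] at htr
    rw [Matrix.det_fin_two] at hdet
    have hd : B 1 1 = r - B 0 0 := by linarith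
    have hq : B 0 0 * (r - B 0 0) - s = B 0 1 * B 1 0 := by rw [← hd, ← hdet]; ring
    have hb : (B 0 0 * (r - B 0 0) - s) / B 1 0 = B 0 1 := Int.ediv_eq_of_eq_mul_left hc hq
    have hΔ : (B 0 0 + B 1 1) ^ 2 - 4 * (B 0 0 * B 1 1 - B 0 1 * B 1 0) = r ^ 2 - 4 * s := by rw [htr, hdet]
    obtain ⟨hcle, hale⟩ := abs_le_and_abs_le hc hcb h₁ h₂
    rw [hΔ] at hcle hale
    rw [htr] at hale
    rw [hd] at h₁ h₂ h₃
    refine ⟨⟨⟨abs_le.1 hale, abs_le.1 hcle⟩, hc, ⟨B 0 1, by rw [hq, mul_comm]⟩, ?_, by linarith, by linarith, ?_⟩, ?_⟩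
    · rw [hb]; exact hcb
    · rw [hb]; intro h; linarith [h₃ h]
    · rw [hb, ← hd]; exact Matrix.eta_fin_two B
  · rintro ⟨⟨-, hc, hdvd, hcb, h₁, h₂, h₃⟩, hB⟩
    have h01 : B 0 1 = (B 0 0 * (r - B 0 0) - s) / B 1 0 := by
      conv_lhs => rw [hB]
      simp
    have h11 : B 1 1 = r - B 0 0 := by
      conv_lhs => rw [hB]
      simp
    refine ⟨by rw [Matrix.trace_fin_two, h11]; ring, ?_, hc, by rw [h01]; exact hcb, by rw [h11]; linarith,
      by rw [h11]; linarith, fun h => by rw [h11]; rw [h01] at h; linarith [h₃ h]⟩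
    rw [Matrix.det_fin_two, h11, h01, Int.ediv_mul_cancel hdvd]
    ring

/-- **`|M(r, s)| = |T(r, s)|`** (Theorem 7.10 (b) «`M(r, s)` is finite», with its cardinality computed by the
finset of pairs `(a, c)`). [cite: HertlingLarabi2026b, §7.3 Theorem 7.10 (b), chunk p0017] -/
theorem natCard_normalForms_eq_card (r s : ℤ) :
    Nat.card {B : Matrix (Fin 2) (Fin 2) ℤ | B.trace = r ∧ B.det = s ∧ B 1 0 ≠ 0 ∧ |B 1 0| ≤ |B 0 1| ∧
        -|B 1 0| < B 0 0 - B 1 1 ∧ B 0 0 - B 1 1 ≤ |B 1 0| ∧ (|B 1 0| = |B 0 1| → 0 ≤ B 0 0 - B 1 1)} =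
      (((Finset.Icc (-(|r ^ 2 - 4 * s| / 3 + |r|)) (|r ^ 2 - 4 * s| / 3 + |r|)) ×ˢ
          (Finset.Icc (-(|r ^ 2 - 4 * s| / 3)) (|r ^ 2 - 4 * s| / 3))).filter
          (fun p : ℤ × ℤ => p.2 ≠ 0 ∧ p.2 ∣ p.1 * (r - p.1) - s ∧ |p.2| ≤ |(p.1 * (r - p.1) - s) / p.2| ∧
            -|p.2| < 2 * p.1 - r ∧ 2 * p.1 - r ≤ |p.2| ∧
              (|p.2| = |(p.1 * (r - p.1) - s) / p.2| → 0 ≤ 2 * p.1 - r))).card := by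
  set N := {B : Matrix (Fin 2) (Fin 2) ℤ | B.trace = r ∧ B.det = s ∧ B 1 0 ≠ 0 ∧ |B 1 0| ≤ |B 0 1| ∧
    -|B 1 0| < B 0 0 - B 1 1 ∧ B 0 0 - B 1 1 ≤ |B 1 0| ∧ (|B 1 0| = |B 0 1| → 0 ≤ B 0 0 - B 1 1)} with hN
  set T := ((Finset.Icc (-(|r ^ 2 - 4 * s| / 3 + |r|)) (|r ^ 2 - 4 * s| / 3 + |r|)) ×ˢ
      (Finset.Icc (-(|r ^ 2 - 4 * s| / 3)) (|r ^ 2 - 4 * s| / 3))).filter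
      (fun p : ℤ × ℤ => p.2 ≠ 0 ∧ p.2 ∣ p.1 * (r - p.1) - s ∧ |p.2| ≤ |(p.1 * (r - p.1) - s) / p.2| ∧
        -|p.2| < 2 * p.1 - r ∧ 2 * p.1 - r ≤ |p.2| ∧
          (|p.2| = |(p.1 * (r - p.1) - s) / p.2| → 0 ≤ 2 * p.1 - r)) with hT
  have hmem : ∀ B : Matrix (Fin 2) (Fin 2) ℤ, B ∈ N ↔
      (B 0 0, B 1 0) ∈ T ∧ B = !![B 0 0, (B 0 0 * (r - B 0 0) - s) / B 1 0; B 1 0, r - B 0 0] := fun B => by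
    rw [hN, hT]; exact mem_normalForms_iff r s B
  have hX : ∀ a c : ℤ, (!![a, (a * (r - a) - s) / c; c, r - a] : Matrix (Fin 2) (Fin 2) ℤ) 0 0 = a ∧
      (!![a, (a * (r - a) - s) / c; c, r - a] : Matrix (Fin 2) (Fin 2) ℤ) 1 0 = c := fun a c => by simp
  let f : T → N := fun p => ⟨!![p.1.1, (p.1.1 * (r - p.1.1) - s) / p.1.2; p.1.2, r - p.1.1], by
    rw [hmem, (hX _ _).1, (hX _ _).2]
    exact ⟨p.2, rfl⟩⟩
  have hf : Function.Bijective f := by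
    constructor
    · intro p p' h
      have h' := congrArg (fun M : N => (M.1 0 0, M.1 1 0)) h
      simp only [f, (hX _ _).1, (hX _ _).2, Prod.mk.eta] at h'
      exact Subtype.ext h'
    · intro B
      obtain ⟨hBT, hBeq⟩ := (hmem B.1).1 B.2
      exact ⟨⟨(B.1 0 0, B.1 1 0), hBT⟩, Subtype.ext hBeq.symm⟩
  rw [← Nat.card_eq_finsetCard T, ← Nat.card_congr (Equiv.ofBijective f hf)]

/-! ## §2 The class numbers for `D < 0` as finset cardinalities -/

/-- **THEOREM 7.10 (c)(iii), computable: for `r² − 4s < 0` the number of `SL₂(ℤ)`-conjugacy classes of integer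
`2 × 2` matrices with characteristic polynomial `t² − rt + s` is `|T(r, s)|`** (one normal form per class).
[cite: HertlingLarabi2026b, §7.3 Theorem 7.10 (b)(c)(iii), chunks p0017–p0018] -/
theorem natCard_quot_sl2_conj_eq_card {r s : ℤ} (hΔ : r ^ 2 - 4 * s < 0) :
    Nat.card (Quot fun B B' : {B : Matrix (Fin 2) (Fin 2) ℤ // B.trace = r ∧ B.det = s} =>
        ∃ γ : Matrix (Fin 2) (Fin 2) ℤ, γ.det = 1 ∧ γ * B'.1 = B.1 * γ) =
      (((Finset.Icc (-(|r ^ 2 - 4 * s| / 3 + |r|)) (|r ^ 2 - 4 * s| / 3 + |r|)) ×ˢ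
          (Finset.Icc (-(|r ^ 2 - 4 * s| / 3)) (|r ^ 2 - 4 * s| / 3))).filter
          (fun p : ℤ × ℤ => p.2 ≠ 0 ∧ p.2 ∣ p.1 * (r - p.1) - s ∧ |p.2| ≤ |(p.1 * (r - p.1) - s) / p.2| ∧
            -|p.2| < 2 * p.1 - r ∧ 2 * p.1 - r ≤ |p.2| ∧
              (|p.2| = |(p.1 * (r - p.1) - s) / p.2| → 0 ≤ 2 * p.1 - r))).card := by
  rw [natCard_quot_sl2_conj_eq hΔ, natCard_normalForms_eq_card]

/-- **THEOREM 7.9 (b) with 7.10 (c)(iii), computable: for `r² − 4s < 0` the number of `GL₂(ℤ)`-conjugacy classes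
of integer `2 × 2` matrices with characteristic polynomial `t² − rt + s` is `|T(r, s)|/2`.**
[cite: HertlingLarabi2026b, §7.2 Theorem 7.9 (b) and §7.3 Theorem 7.10 (c)(iii), chunks p0016–p0018] -/
theorem natCard_quot_gl2_conj_eq_card_div_two {r s : ℤ} (hΔ : r ^ 2 - 4 * s < 0) :
    Nat.card (Quot fun B B' : {B : Matrix (Fin 2) (Fin 2) ℤ // B.trace = r ∧ B.det = s} =>
        ∃ P : Matrix (Fin 2) (Fin 2) ℤ, IsUnit P.det ∧ P * B.1 = B'.1 * P) =
      (((Finset.Icc (-(|r ^ 2 - 4 * s| / 3 + |r|)) (|r ^ 2 - 4 * s| / 3 + |r|)) ×ˢ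
          (Finset.Icc (-(|r ^ 2 - 4 * s| / 3)) (|r ^ 2 - 4 * s| / 3))).filter
          (fun p : ℤ × ℤ => p.2 ≠ 0 ∧ p.2 ∣ p.1 * (r - p.1) - s ∧ |p.2| ≤ |(p.1 * (r - p.1) - s) / p.2| ∧
            -|p.2| < 2 * p.1 - r ∧ 2 * p.1 - r ≤ |p.2| ∧
              (|p.2| = |(p.1 * (r - p.1) - s) / p.2| → 0 ≤ 2 * p.1 - r))).card / 2 := by
  rw [← natCard_quot_sl2_conj_eq_card hΔ, natCard_quot_sl2_eq_two_mul hΔ, Nat.mul_div_cancel_left _ two_pos]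

/-! ## §3 EXAMPLES 7.11, computed -/

/-- **EXAMPLES 7.11 (i): `|M(0, 5)| = |T(0, 5)| = 4`.** [cite: HertlingLarabi2026b, §7.3 Examples 7.11 (i), chunk p0018] -/
theorem card_T_zero_five :
    (((Finset.Icc (-(|(0 : ℤ) ^ 2 - 4 * 5| / 3 + |(0 : ℤ)|)) (|(0 : ℤ) ^ 2 - 4 * 5| / 3 + |(0 : ℤ)|)) ×ˢ
          (Finset.Icc (-(|(0 : ℤ) ^ 2 - 4 * 5| / 3)) (|(0 : ℤ) ^ 2 - 4 * 5| / 3))).filter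
          (fun p : ℤ × ℤ => p.2 ≠ 0 ∧ p.2 ∣ p.1 * (0 - p.1) - 5 ∧ |p.2| ≤ |(p.1 * (0 - p.1) - 5) / p.2| ∧
            -|p.2| < 2 * p.1 - 0 ∧ 2 * p.1 - 0 ≤ |p.2| ∧
              (|p.2| = |(p.1 * (0 - p.1) - 5) / p.2| → 0 ≤ 2 * p.1 - 0))).card = 4 := by
  decide +kernel

/-- **EXAMPLES 7.11 (ii): «`M(0, 20)` contains 12 matrices»** — `|T(0, 20)| = 12`.
[cite: HertlingLarabi2026b, §7.3 Examples 7.11 (ii), chunks p0018–p0019] -/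
theorem card_T_zero_twenty :
    (((Finset.Icc (-(|(0 : ℤ) ^ 2 - 4 * 20| / 3 + |(0 : ℤ)|)) (|(0 : ℤ) ^ 2 - 4 * 20| / 3 + |(0 : ℤ)|)) ×ˢ
          (Finset.Icc (-(|(0 : ℤ) ^ 2 - 4 * 20| / 3)) (|(0 : ℤ) ^ 2 - 4 * 20| / 3))).filter
          (fun p : ℤ × ℤ => p.2 ≠ 0 ∧ p.2 ∣ p.1 * (0 - p.1) - 20 ∧ |p.2| ≤ |(p.1 * (0 - p.1) - 20) / p.2| ∧
            -|p.2| < 2 * p.1 - 0 ∧ 2 * p.1 - 0 ≤ |p.2| ∧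
              (|p.2| = |(p.1 * (0 - p.1) - 20) / p.2| → 0 ≤ 2 * p.1 - 0))).card = 12 := by
  decide +kernel

/-- **EXAMPLES 7.11 (ii): «so there are 12 `SL_2(ℤ)` conjugacy classes […] of matrices with characteristic polynomial
`p_2(t) = t² + 20`».** [cite: HertlingLarabi2026b, §7.3 Examples 7.11 (ii), chunk p0019] -/
theorem natCard_quot_sl2_conj_zero_twenty :
    Nat.card (Quot fun B B' : {B : Matrix (Fin 2) (Fin 2) ℤ // B.trace = 0 ∧ B.det = 20} =>
        ∃ γ : Matrix (Fin 2) (Fin 2) ℤ, γ.det = 1 ∧ γ * B'.1 = B.1 * γ) = 12 := by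
  rw [natCard_quot_sl2_conj_eq_card (by norm_num), card_T_zero_twenty]

/-- **EXAMPLES 7.11 (ii): «and 6 `GL_2(ℤ)`-conjugacy classes of matrices with characteristic polynomial
`p_2(t) = t² + 20`».** [cite: HertlingLarabi2026b, §7.3 Examples 7.11 (ii), chunk p0019] -/
theorem natCard_quot_gl2_conj_zero_twenty :
    Nat.card (Quot fun B B' : {B : Matrix (Fin 2) (Fin 2) ℤ // B.trace = 0 ∧ B.det = 20} =>
        ∃ P : Matrix (Fin 2) (Fin 2) ℤ, IsUnit P.det ∧ P * B.1 = B'.1 * P) = 6 := by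
  rw [natCard_quot_gl2_conj_eq_card_div_two (by norm_num), card_T_zero_twenty]

/-- A check in the principal case `t² + 1` (`ℤ[i]`): `|M(0, 1)| = 2`, i.e. two `SL₂(ℤ)`-classes `[S]`, `[−S]` and one
`GL₂(ℤ)`-class of integer matrices with `B² = −E_2`. [cite: HertlingLarabi2026b, §7.3 Theorem 7.10 (b)(c)(iii), chunks p0017–p0018] -/
theorem card_T_zero_one :
    (((Finset.Icc (-(|(0 : ℤ) ^ 2 - 4 * 1| / 3 + |(0 : ℤ)|)) (|(0 : ℤ) ^ 2 - 4 * 1| / 3 + |(0 : ℤ)|)) ×ˢ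
          (Finset.Icc (-(|(0 : ℤ) ^ 2 - 4 * 1| / 3)) (|(0 : ℤ) ^ 2 - 4 * 1| / 3))).filter
          (fun p : ℤ × ℤ => p.2 ≠ 0 ∧ p.2 ∣ p.1 * (0 - p.1) - 1 ∧ |p.2| ≤ |(p.1 * (0 - p.1) - 1) / p.2| ∧
            -|p.2| < 2 * p.1 - 0 ∧ 2 * p.1 - 0 ≤ |p.2| ∧
              (|p.2| = |(p.1 * (0 - p.1) - 1) / p.2| → 0 ≤ 2 * p.1 - 0))).card = 2 := by
  decide +kernel

/-- A type IV check (`t² − 2`, `4D = 8` not a square): the set `M(0, −2)` of SEMI-normal forms has `2` elements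
(`(0 2; 1 0)` and `(0 −2; −1 0)`; Theorem 7.10 (c)(ii)). [cite: HertlingLarabi2026b, §7.3 Theorem 7.10 (b)(c)(ii), chunks p0017–p0018] -/
theorem card_T_zero_neg_two :
    (((Finset.Icc (-(|(0 : ℤ) ^ 2 - 4 * (-2)| / 3 + |(0 : ℤ)|)) (|(0 : ℤ) ^ 2 - 4 * (-2)| / 3 + |(0 : ℤ)|)) ×ˢ
          (Finset.Icc (-(|(0 : ℤ) ^ 2 - 4 * (-2)| / 3)) (|(0 : ℤ) ^ 2 - 4 * (-2)| / 3))).filter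
          (fun p : ℤ × ℤ => p.2 ≠ 0 ∧ p.2 ∣ p.1 * (0 - p.1) - (-2) ∧ |p.2| ≤ |(p.1 * (0 - p.1) - (-2)) / p.2| ∧
            -|p.2| < 2 * p.1 - 0 ∧ 2 * p.1 - 0 ≤ |p.2| ∧
              (|p.2| = |(p.1 * (0 - p.1) - (-2)) / p.2| → 0 ≤ 2 * p.1 - 0))).card = 2 := by
  decide +kernel

end Literature.LinearAlgebra.Matrix.SL2ZNormalFormsEnumeration
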